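import Literature.AnabelianGeometry.EtaleTheta.ThetaCovers
import Mathlib.Topology.Instances.ZMod
import Mathlib.GroupTheory.QuotientGroup.Basic
import Mathlib.Algebra.Group.PUnit

/-!
# [EtTh] Prop 2.2 (i) and Rmk 2.1.1: the named facts `CoverData.Prop22_i` (F-0596) and
# `CoverData.Rmk211` (F-0599) have REFUTABLE universal closures over the BARE interface `CoverData`

Mochizuki, *The Étale Theta Function and its Frobenioid-theoretic manifestations* [EtTh], Publ. RIMS
**45** (2009), §2: Remark 2.1.1, PRIMS printed p. 262 (PDF p. 36); Proposition 2.2 (i), printed p. 263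
(PDF p. 37); bib key `MochizukiEtTh2009`.

PROOF-ONLY w.r.t. the frozen trunk (nothing landed is edited or restated; no `Prop` fact, no instance, no
notation): negative knowledge recorded next to abc-iut-L2-t2's `ThetaCovers.lean` (p405102) and
`ThetaCoversAxioms.lean`. Cell abc-iut, block C / W6 row `EtTh:Prop2.2(iii)` (seat abc-iut-w6-d083),
FACT-LIST rows F-0596 `CoverData.Prop22_i`, F-0599 `CoverData.Rmk211`.

State of record before this file. Both named facts are `def … : Prop` on the bare interface
`ThetaCovers.CoverData l` (pp. 35–36: `Π_X ⊆ Π_C` of index `2`, `G_K`, `Ker(Δ_X ↠ Δ̄_X)`, the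
`Δ̄_Θ`-preimage, `D_x`), and both are DISCHARGED over the richer interface `CoverDataAx`
(`CoverDataAx.prop22_i_holds`, `Discharge/Sec2InversionProofs.lean`; `CoverDataAx.rmk211_holds`,
`ThetaCoversAxioms.lean`) which adds three printed facts: `Δ̄_X` has exponent `l` (`pow_mem_barKer`) and an
element of `Δ_C ∖ Δ_X` acts by `−1` on `Δ̄^ell_X` (`inv_ell`, "`ι` acts on `Q` by multiplication by `−1`",
Rmk 2.1.1) and by `+1` on `Δ̄_Θ` (`inv_theta`, "eigenvalues `−1` and `1`", Prop 2.2 (i)). By contrast the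
sibling fact `Prop22_ii` (F-0597) holds over the BARE interface (abc-iut-w6-d082, `CoverData.prop22_ii_holds`,
`Discharge/Sec2Prop22iiOfCoverData.lean`), and the same route is open for `Prop22_iii` (F-0598): their
hypothesis `IsMinusEigen H H' ι E` already carries the eigen-action of the given inversion, and the odd
indices `[Δ̄_Θ-preimage : Ker] = l`, `[E : Ker] = l` replace the exponent axiom.

WHAT IS SHOWN HERE: for (i) and Rmk 2.1.1 the supplement is NECESSARY — the universal closures of F-0596
and F-0599 over `CoverData` are FALSE. Witness (`BareToy.toy : CoverData 3`): the abelian group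
`Π_C := (ℤ/3 × ℤ/3) × ℤ/3 × ℤ/2` (discrete), coordinates `((a₁, a₂), t, w)`, with `Π_X := {w = 0}`,
`G_K := 1`, `Ker(Δ_X ↠ Δ̄_X) := 1`, `Δ̄_Θ`-preimage `:= D_x := {a = 0, w = 0}` (so `Δ_X/Δ̄_Θ ≅ (ℤ/3)²`,
`Δ̄_Θ` central, `I_x · Ker = Δ̄_Θ`): every axiom of `CoverData 3` holds, but the inversion
`ι := (0, 0, 0, 1) ∈ Δ_C ∖ Π_X` of the type-`(1, l-tors)±` subgroup `Π_{C̲} := {a₁ = 0}` acts TRIVIALLY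
by conjugation, so

* `BareToy.toy_not_prop22_i` — no `(−1)`-eigenspace `E` with `E · Δ̄_Θ = Δ_{X̲}` exists
  (`ι e ι⁻¹ e = e² = 1` forces `e = 1` in odd order, while `Δ_{X̲}/Δ̄_Θ ≅ ℤ/3 ≠ 1`): `¬ toy.Prop22_i`;
* `BareToy.toy_not_rmk211` — `N_{Π_C}(Π_{C̲}) = Π_C`, so `N_{Π_C}(Π_{C̲}) ∩ Π_X = Π_X ≠ Π_{X̲}`:
  `¬ toy.Rmk211`;
* `CoverData.not_forall_prop22_i`, `CoverData.not_forall_rmk211` — the universal closures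
  `∀ l (X : CoverData l), X.Prop22_i` / `X.Rmk211` are false (FACT-LIST class «universal-closure REFUTED;
  instance forms model-witnessed»: `CoverDataAx.prop22_i_holds`, `CoverDataAx.rmk211_holds`,
  `prop22_i_ofSetting` stay the instance forms).

Elementary group theory; refuted-as-a-universal-closure is a statement about OUR typing of an assumption
label (the bare interface does not record how the inversion acts on `Δ̄_X`), not about [EtTh], a refereed
paper whose Prop 2.2 concerns the genuine curve data, where `ι` does act by `∓1`. Nothing here bears on
the disputed [IUTchIII] Cor 3.12 or takes a side; typed ≠ proved elsewhere.
-/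

namespace Literature.AnabelianGeometry.EtaleTheta

namespace ThetaCovers

namespace CoverData

namespace BareToy

open Multiplicative

/-! ### The toy group `Π_C = (ℤ/3 × ℤ/3) × ℤ/3 × ℤ/2` and its coordinate homomorphisms -/

/-- Additive carrier of the toy `Π_C`: coordinates `((a₁, a₂), t, w)` — `a` the `Δ̄^ell` part, `t` the
`Δ̄_Θ` part, `w` the `Gal(X/C) ≅ ℤ/2` part. [folklore] -/
abbrev V : Type := (ZMod 3 × ZMod 3) × ZMod 3 × ZMod 2

/-- The toy `Π_C`, written multiplicatively (discrete topology). [folklore] -/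
abbrev G : Type := Multiplicative V

/-- The coordinate `w : Π_C → ℤ/2` (`Π_C ↠ Gal(X/C)`). [folklore] -/
def wA : V →+ ZMod 2 :=
  (AddMonoidHom.snd (ZMod 3) (ZMod 2)).comp (AddMonoidHom.snd (ZMod 3 × ZMod 3) (ZMod 3 × ZMod 2))

/-- The coordinate `a = (a₁, a₂) : Π_C → ℤ/3 × ℤ/3` (`Δ_X ↠ Δ̄^ell_X`). [folklore] -/
def aA : V →+ ZMod 3 × ZMod 3 :=
  AddMonoidHom.fst (ZMod 3 × ZMod 3) (ZMod 3 × ZMod 2)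

/-- The coordinate `a₁ : Π_C → ℤ/3` (the quotient `Q` of Def 2.1 cutting out `Π_{X̲}`). [folklore] -/
def a1A : V →+ ZMod 3 :=
  (AddMonoidHom.fst (ZMod 3) (ZMod 3)).comp aA

/-- The coordinate `a₂ : Π_C → ℤ/3` (detects the `(−1)`-eigenspace that fails to exist). [folklore] -/
def a2A : V →+ ZMod 3 :=
  (AddMonoidHom.snd (ZMod 3) (ZMod 3)).comp aA

/-- The coordinates `(a, w) : Π_C → (ℤ/3 × ℤ/3) × ℤ/2` (kernel = the `Δ̄_Θ`-preimage). [folklore] -/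
def awA : V →+ (ZMod 3 × ZMod 3) × ZMod 2 :=
  aA.prod wA

/-- `w` as a homomorphism of multiplicative groups. [folklore] -/
def wProj : G →* Multiplicative (ZMod 2) :=
  AddMonoidHom.toMultiplicative wA

/-- `a` as a homomorphism of multiplicative groups. [folklore] -/
def aProj : G →* Multiplicative (ZMod 3 × ZMod 3) :=
  AddMonoidHom.toMultiplicative aA

/-- `a₁` as a homomorphism of multiplicative groups. [folklore] -/
def a1Proj : G →* Multiplicative (ZMod 3) :=
  AddMonoidHom.toMultiplicative a1A

/-- `a₂` as a homomorphism of multiplicative groups. [folklore] -/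
def a2Proj : G →* Multiplicative (ZMod 3) :=
  AddMonoidHom.toMultiplicative a2A

/-- `(a, w)` as a homomorphism of multiplicative groups. [folklore] -/
def awProj : G →* Multiplicative ((ZMod 3 × ZMod 3) × ZMod 2) :=
  AddMonoidHom.toMultiplicative awA

/-- The toy `Π_X := {w = 0}` (index `2`). [folklore] -/
def piX : Subgroup G := wProj.ker

/-- The toy `Δ̄_Θ`-preimage `= D_x := {a = 0, w = 0}` (order `3`). [folklore] -/
def theta : Subgroup G := awProj.ker

/-- The toy `Π_{C̲} := {a₁ = 0}` (type `(1, l-tors)±`). [folklore] -/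
def piCu : Subgroup G := a1Proj.ker

/-- The toy inversion `ι := (0, 0, 0, 1) ∈ Δ_C ∖ Π_X`; it is CENTRAL. [folklore] -/
def ι : G := ofAdd ((0, 0), 0, 1)

/-- The element `x₁ := (1, 0, 0, 0) ∈ Π_X ∖ Π_{X̲}`. [folklore] -/
def x₁ : G := ofAdd ((1, 0), 0, 0)

/-- The element `x₂ := (0, 1, 0, 0) ∈ Δ_{X̲} ∖ Δ̄_Θ`-preimage. [folklore] -/
def x₂ : G := ofAdd ((0, 1), 0, 0)

/-- Membership in `Π_X`: `w = 0`. [folklore] -/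
private theorem mem_piX {x : G} : x ∈ piX ↔ x.toAdd.2.2 = 0 := Iff.rfl

/-- Membership in `Π_{C̲}`: `a₁ = 0`. [folklore] -/
private theorem mem_piCu {x : G} : x ∈ piCu ↔ x.toAdd.1.1 = 0 := Iff.rfl

/-- Membership in the `Δ̄_Θ`-preimage: `a = 0` and `w = 0`. [folklore] -/
private theorem mem_theta {x : G} : x ∈ theta ↔ x.toAdd.1 = 0 ∧ x.toAdd.2.2 = 0 := by
  change Multiplicative.ofAdd (x.toAdd.1, x.toAdd.2.2) = 1 ↔ _
  rw [ofAdd_eq_one, Prod.mk_eq_zero]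

/-- `w` is onto. [folklore] -/
private theorem wProj_surjective : Function.Surjective wProj :=
  fun c => ⟨ofAdd ((0, 0), 0, c.toAdd), rfl⟩

/-- `(a, w)` is onto. [folklore] -/
private theorem awProj_surjective : Function.Surjective awProj :=
  fun c => ⟨ofAdd (c.toAdd.1, 0, c.toAdd.2), rfl⟩

/-- `[Π_C : Π_X] = 2`. [folklore] -/
private theorem index_piX : piX.index = 2 := by
  rw [piX, Subgroup.index_ker, MonoidHom.range_eq_top.mpr wProj_surjective, Subgroup.card_top,
    Nat.card_eq_fintype_card, Fintype.card_multiplicative, ZMod.card]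

/-- `#Π_C = 54`. [folklore] -/
private theorem card_G : Nat.card G = 54 := by
  rw [Nat.card_eq_fintype_card, Fintype.card_multiplicative, Fintype.card_prod, Fintype.card_prod,
    Fintype.card_prod, ZMod.card, ZMod.card]

/-- The `Δ̄_Θ`-preimage has order `3` ("`Δ̄_Θ ≅ (ℤ/lℤ)(1)`"). [folklore] -/
private theorem card_theta : Nat.card theta = 3 := by
  have h1 : theta.index = 18 := by
    rw [theta, Subgroup.index_ker, MonoidHom.range_eq_top.mpr awProj_surjective, Subgroup.card_top,
      Nat.card_eq_fintype_card, Fintype.card_multiplicative, Fintype.card_prod, Fintype.card_prod,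
      ZMod.card, ZMod.card]
  have h2 := theta.card_mul_index
  rw [h1, card_G] at h2
  omega

/-- `Δ̄_Θ`-preimage `⊆ Π_{C̲} ∩ Π_X`. [folklore] -/
private theorem theta_le_piCu_inf_piX : theta ≤ piCu ⊓ piX := by
  intro x hx
  rw [mem_theta] at hx
  refine ⟨?_, hx.2⟩
  show x.toAdd.1.1 = 0
  rw [hx.1]
  rfl

/-- `Δ̄_Θ`-preimage `⊆ Π_X ∩ Δ_C` (`Δ_C = Π_C` as `G_K = 1`). [folklore] -/
private theorem theta_le_piX_inf_ker : theta ≤ piX ⊓ (1 : G →* PUnit).ker :=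
  fun _ hx => ⟨(mem_theta.mp hx).2, rfl⟩

/-- "`Δ̄^ell_X` is a free `(ℤ/lℤ)`-module of rank `2`" in the toy: `Δ_X / Δ̄_Θ`-preimage `≅ (ℤ/3)²` via
`a`. [cite: MochizukiEtTh2009, Def 2.1 p.35] -/
theorem ell_rank_two_toy : Nonempty (↥(piX ⊓ (1 : G →* PUnit).ker) ⧸
    theta.subgroupOf (piX ⊓ (1 : G →* PUnit).ker) ≃* Multiplicative (ZMod 3 × ZMod 3)) := by
  let ψ : ↥(piX ⊓ (1 : G →* PUnit).ker) →* Multiplicative (ZMod 3 × ZMod 3) :=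
    aProj.comp (Subgroup.subtype _)
  have hψ : Function.Surjective ψ := fun c =>
    ⟨⟨ofAdd (c.toAdd, 0, 0), show (0 : ZMod 2) = 0 from rfl, rfl⟩, rfl⟩
  have hker : ψ.ker = theta.subgroupOf (piX ⊓ (1 : G →* PUnit).ker) := by
    ext ⟨x, hx⟩
    rw [MonoidHom.mem_ker, Subgroup.mem_subgroupOf, mem_theta]
    change Multiplicative.ofAdd x.toAdd.1 = 1 ↔ _
    rw [ofAdd_eq_one]
    exact ⟨fun h => ⟨h, hx.1⟩, fun h => h.1⟩
  exact ⟨(QuotientGroup.quotientMulEquivOfEq hker.symm).trans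
    (QuotientGroup.quotientKerEquivOfSurjective ψ hψ)⟩

/-! ### The toy `CoverData 3` -/

/-- **The witness**: an abelian `CoverData 3` — `Π_C = (ℤ/3 × ℤ/3) × ℤ/3 × ℤ/2` discrete, `G_K = 1`,
`Π_X = {w = 0}`, `Ker(Δ_X ↠ Δ̄_X) = 1`, `Δ̄_Θ`-preimage `= D_x = {a = 0, w = 0}`. Every axiom of the bare
interface holds; the inversion acts trivially. [folklore] -/
abbrev toy : CoverData.{0} 3 where
  l_odd := ⟨1, rfl⟩
  PiC := G
  GK := PUnit
  aug := 1
  PiX := piX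
  PiX_normal := inferInstance
  index_PiX := index_piX
  isOpen_PiX := isOpen_discrete _
  aug_PiX_surjective := fun y => ⟨1, Subsingleton.elim _ _⟩
  barKer := ⊥
  barKer_normal := inferInstance
  isClosed_barKer := isClosed_discrete _
  barTheta := theta
  barTheta_normal := inferInstance
  barKer_le_barTheta := bot_le
  barTheta_le := theta_le_piX_inf_ker
  relIndex_barKer := by rw [Subgroup.relIndex_bot_left, card_theta]
  ell_rank_two := ell_rank_two_toy
  barTheta_central := fun t _ d _ => by
    rw [Subgroup.mem_bot, mul_inv_cancel_comm, mul_inv_cancel]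
  Dx := theta
  Dx_le := fun _ hx => (mem_theta.mp hx).2
  aug_Dx_surjective := fun y => ⟨1, Subsingleton.elim _ _⟩
  inertia_sup_barKer := by rw [sup_bot_eq, MonoidHom.ker_one, inf_top_eq]

/-! ### `Π_{C̲} = {a₁ = 0}` is of type `(1, l-tors)±`, with inversion `ι` -/

/-- `ι ∈ Π_{C̲}`. [folklore] -/
private theorem ι_mem_piCu : ι ∈ piCu := show (0 : ZMod 3) = 0 from rfl

/-- For `b ∈ Π_C`: exactly one of `b`, `b ι` lies in `Π_X`. [folklore] -/
private theorem xor_mem_piX (b : G) : Xor (b * ι ∈ piX) (b ∈ piX) := by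
  have key : ∀ c : ZMod 2, Xor (c + 1 = 0) (c = 0) := by decide
  exact key b.toAdd.2.2

/-- **`Π_{C̲} := {a₁ = 0}` is of type `(1, l-tors)±`** in the toy: `Π_{X̲} = Π_{C̲} ∩ Π_X = Ker(a₁|Π_X)`
with `a₁ : Π_X ↠ ℤ/3` trivial on `D_x` and on the `Δ̄_Θ`-preimage, `Δ_X · Π_{X̲} = Π_X`, and
`[Π_{C̲} : Π_{X̲}] = 2`. [cite: MochizukiEtTh2009, Def 2.1 p.36] -/
theorem isTypeLTorsPm_piCu : toy.IsTypeLTorsPm piCu where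
  inf_isTypeLTors :=
    { le := inf_le_right
      quot := ⟨a1Proj.comp (Subgroup.subtype _),
        fun c => ⟨⟨ofAdd ((c.toAdd, 0), 0, 0), show (0 : ZMod 2) = 0 from rfl⟩, rfl⟩,
        fun g => ⟨fun h => ⟨h, g.2⟩, fun h => h.1⟩⟩
      barTheta_le := theta_le_piCu_inf_piX
      delta_sup := by
        show (piCu ⊓ piX) ⊔ (piX ⊓ (1 : G →* PUnit).ker) = piX
        rw [MonoidHom.ker_one, inf_top_eq]
        exact sup_eq_right.mpr inf_le_right
      Dx_le := theta_le_piCu_inf_piX }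
  relIndex_two := by
    show (piCu ⊓ piX).relIndex piCu = 2
    rw [Subgroup.relIndex_eq_two_iff]
    refine ⟨ι, ι_mem_piCu, fun b hb => ?_⟩
    have hbι : b * ι ∈ piCu := piCu.mul_mem hb ι_mem_piCu
    rcases xor_mem_piX b with ⟨h1, h2⟩ | ⟨h1, h2⟩
    · exact Or.inl ⟨⟨hbι, h1⟩, fun h => h2 h.2⟩
    · exact Or.inr ⟨⟨hb, h1⟩, fun h => h2 h.2⟩

/-- **`ι` is an inversion** of `Π_{C̲}` in the toy: `ι ∈ Π_{C̲} ∩ Δ_C ∖ Π_X`.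
[cite: MochizukiEtTh2009, Prop 2.2 p.36] -/
theorem isInversion_ι : toy.IsInversion piCu ι where
  mem := ι_mem_piCu
  mem_delta := rfl
  not_mem := fun h => absurd (mem_piX.mp h) (by decide)

/-! ### The refutations -/

/-- **F-0596, universal closure REFUTED at the toy**: `CoverData.Prop22_i` FAILS for `toy` — the
inversion `ι` acts trivially, so a `(−1)`-eigenspace `E ⊆ Δ_{X̲}` would satisfy `e² = ι e ι⁻¹ e ∈ Ker = 1`,
hence `a₂(e) = 0`, for all `e ∈ E`; as `a₂ = 0` on the `Δ̄_Θ`-preimage too, `a₂` would vanish on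
`E · Δ̄_Θ = Δ_{X̲} ∋ x₂ = (0, 1, 0, 0)`, but `a₂(x₂) = 1`. [cite: MochizukiEtTh2009, Prop 2.2(i) p.37] -/
theorem toy_not_prop22_i :
    ¬ Literature.AnabelianGeometry.EtaleTheta.ThetaCovers.CoverData.Prop22_i toy := by
  intro h
  obtain ⟨E, hE, -⟩ := h (piCu ⊓ piX) piCu ι isTypeLTorsPm_piCu rfl isInversion_ι
  -- `a₂` vanishes on `E` (squares are trivial there) …
  have hE2 : ∀ e ∈ E, a2Proj e = 1 := by
    intro e he
    have h1 : ι * e * ι⁻¹ * e ∈ (⊥ : Subgroup G) := hE.minus e he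
    rw [mul_inv_cancel_comm, Subgroup.mem_bot] at h1
    have h2 : a2Proj e * a2Proj e = 1 := by rw [← map_mul, h1, map_one]
    have key : ∀ c : Multiplicative (ZMod 3), c * c = 1 → c = 1 := by decide
    exact key _ h2
  -- … and on the `Δ̄_Θ`-preimage
  have hT2 : ∀ t ∈ theta, a2Proj t = 1 := fun t ht => by
    have h := (mem_theta.mp ht).1
    change Multiplicative.ofAdd (toAdd t).1.2 = 1
    rw [h]
    rfl
  -- but `x₂ ∈ Δ_{X̲} = E · Δ̄_Θ`-preimage has `a₂(x₂) = 1`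
  have hx : x₂ ∈ E ⊔ toy.barTheta := by
    rw [hE.sup_eq]
    exact ⟨⟨show (0 : ZMod 3) = 0 from rfl, show (0 : ZMod 2) = 0 from rfl⟩, rfl⟩
  obtain ⟨y, hy, z, hz, hyz⟩ := Subgroup.mem_sup.mp hx
  have h0 : a2Proj x₂ = 1 := by rw [← hyz, map_mul, hE2 y hy, hT2 z hz, mul_one]
  exact absurd h0 (by decide)

/-- **F-0599, universal closure REFUTED at the toy**: `CoverData.Rmk211` FAILS for `toy` — `Π_C` is
abelian, so `N_{Π_C}(Π_{C̲}) ∩ Π_X = Π_X`, which contains `x₁ = (1, 0, 0, 0) ∉ Π_{X̲} = Π_{C̲} ∩ Π_X`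
("no nontrivial automorphism of odd order descends" fails when the inversion acts trivially on `Q`).
[cite: MochizukiEtTh2009, Rmk 2.1.1 p.36] -/
theorem toy_not_rmk211 :
    ¬ Literature.AnabelianGeometry.EtaleTheta.ThetaCovers.CoverData.Rmk211 toy := by
  intro h
  have h1 : Subgroup.normalizer (piCu : Set G) ⊓ piX = piCu ⊓ piX := h piCu isTypeLTorsPm_piCu
  rw [CommGroup.normalizer_eq_top, top_inf_eq] at h1
  have hx : x₁ ∈ piX := show (0 : ZMod 2) = 0 from rfl
  rw [h1] at hx
  exact absurd (mem_piCu.mp hx.1) (by decide)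

end BareToy

/-- **[EtTh] Prop 2.2 (i) as a named fact on the BARE interface (F-0596): universal closure REFUTED** —
`¬ ∀ l (X : CoverData l), X.Prop22_i` (witness `BareToy.toy`, `l = 3`). The instance forms
`CoverDataAx.prop22_i_holds` / `prop22_i_ofSetting` are unaffected: the bare interface does not record
that the inversion acts by `−1` on `Δ̄^ell_X` and `+1` on `Δ̄_Θ`, which is exactly what (i) needs.
[cite: MochizukiEtTh2009, Prop 2.2(i) p.37] -/
theorem not_forall_prop22_i :
    ¬ ∀ (l : ℕ) (X : Literature.AnabelianGeometry.EtaleTheta.ThetaCovers.CoverData.{0} l),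
      Literature.AnabelianGeometry.EtaleTheta.ThetaCovers.CoverData.Prop22_i X :=
  fun h => BareToy.toy_not_prop22_i (h 3 BareToy.toy)

/-- **[EtTh] Rmk 2.1.1 as a named fact on the BARE interface (F-0599): universal closure REFUTED** —
`¬ ∀ l (X : CoverData l), X.Rmk211` (witness `BareToy.toy`, `l = 3`). The instance form
`CoverDataAx.rmk211_holds` (which uses "`ι` acts on `Q` by `−1`", `CoverDataAx.inv_ell`) is unaffected.
[cite: MochizukiEtTh2009, Rmk 2.1.1 p.36] -/
theorem not_forall_rmk211 :
    ¬ ∀ (l : ℕ) (X : Literature.AnabelianGeometry.EtaleTheta.ThetaCovers.CoverData.{0} l),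
      Literature.AnabelianGeometry.EtaleTheta.ThetaCovers.CoverData.Rmk211 X :=
  fun h => BareToy.toy_not_rmk211 (h 3 BareToy.toy)

end CoverData

end ThetaCovers

end Literature.AnabelianGeometry.EtaleTheta
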